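import Literature.Probability.RandomPlanarGeometry.LocalMartingaleProofs
import Literature.Probability.Process.StoppedMartingale
import Literature.Probability.Process.ContinuousHitting
import HarnessLib

/-!
# Exit of the canonical Brownian motion from an interval: gambler's ruin and `E[τ] = -ab`

Topic `Probability/RandomPlanarGeometry` (next to `LocalMartingaleProofs`, whose Brownian
martingales it stops, and `BrownianStrongMarkov`). Everything here is PROVED; no named fact is
introduced.

For the canonical Brownian motion `B = Process.brownian` on the pre-Wiener space
(`Process.preWienerMeasure`, raw natural filtration `brownianFiltration`) and levels `a < 0 < b`,
let `τ = Process.exitTime Process.brownian a b` be the exit time of `(a, b)` (a stopping time,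
`isStoppingTime_exitTime_brownian`) and `S_t = B_{t ∧ τ}` the stopped path. We prove the two
textbook facts consumed by the Skorokhod embedding (Durrett (2019), Thm. 8.1.1; Lawler–Schramm–
Werner (2004), Lemma 3.8):

* `integral_min_exitTime_brownian_eq` — `E[t ∧ τ] = E[S_t²]` (optional stopping of `B² - t` at
  the optional time `τ`, `Martingale.isAEMartingale_stoppedProcess`), hence
  `E[t ∧ τ] ≤ max (a²) (b²)` and **`τ < ∞` a.s.** (`ae_exitTime_brownian_ne_top`);
* **gambler's ruin** (Durrett (2019), Thm. 7.5.3 at `x = 0`): `B_τ ∈ {a, b}` a.s.,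
  `P[B_τ = b] = -a/(b-a)` and `P[B_τ = a] = b/(b-a)` (`measureReal_brownianExitRight`,
  `measureReal_brownianExitLeft`), from `E[S_t] = 0` and bounded convergence `S_t → B_τ`;
* **`E[τ] = -ab = E[B_τ²]`** (Durrett (2019), Thm. 7.5.5): `integral_brownianExitTimeReal`,
  `integral_brownianExitValue_sq`, by monotone/bounded convergence in `E[t ∧ τ] = E[S_t²]`.

The exit value is `brownianExitValue a b = stoppedValue B τ` (junk: an arbitrary value of the
path on the null event `τ = ⊤`), the exit events are `brownianExitLeft a b = {τ < ⊤, B_τ = a}`,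
`brownianExitRight a b = {τ < ⊤, B_τ = b}`, and the real-valued exit time is
`brownianExitTimeReal a b = (τ.untopD 0 : ℝ)` (junk `0` on `τ = ⊤`).

## References

* R. Durrett, *Probability: Theory and Examples*, 5th ed. (2019), Thm. 7.5.3, Thm. 7.5.5.
* D. Revuz, M. Yor, *Continuous Martingales and Brownian Motion* (1999), Ch. II, §3.
* G. F. Lawler, O. Schramm, W. Werner, *Conformal invariance of planar loop-erased random walks
  and uniform spanning trees*, Ann. Probab. 32 (2004), Lemma 3.8 (where these facts are used).
-/

noncomputable section

open MeasureTheory ProbabilityTheory Filter Set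
open scoped NNReal ENNReal Topology

namespace Literature.Probability.RandomPlanarGeometry

open Literature.Probability.Process

variable {a b : ℝ}

/-! ### The exit time of `(a, b)` by the canonical Brownian motion -/

/-- **The exit time of `(a, b)` by the canonical Brownian motion is a stopping time** of the raw
Brownian filtration (continuous adapted process, closed target set).
Revuz–Yor (1999), Ch. I, §4, Prop. (4.6). [folklore] -/
theorem isStoppingTime_exitTime_brownian (a b : ℝ) :
    IsStoppingTime brownianFiltration (Process.exitTime Process.brownian a b) :=
  Process.isStoppingTime_exitTime adapted_brownian Process.continuous_brownian

/-- The exit time is a measurable random time. [folklore] -/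
theorem measurable_exitTime_brownian (a b : ℝ) :
    Measurable (Process.exitTime Process.brownian a b) :=
  (isStoppingTime_exitTime_brownian a b).measurable'

/-- The event `{τ = ⊤}` ("the path never leaves `(a, b)`") is measurable. [folklore] -/
theorem measurableSet_exitTime_brownian_eq_top (a b : ℝ) :
    MeasurableSet {ω | Process.exitTime Process.brownian a b ω = ⊤} :=
  (isStoppingTime_exitTime_brownian a b).measurableSet_eq_top

/-- For `a < 0 < b` the Brownian path starts inside `(a, b)` (`B_0 = 0`). [folklore] -/
theorem brownian_zero_mem_Ioo (ha : a < 0) (hb : 0 < b) (ω : ℝ≥0 → ℝ) :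
    Process.brownian 0 ω ∈ Ioo a b := by
  rw [Process.brownian_zero]
  exact ⟨ha, hb⟩

/-- For `a < 0 < b` the exit time is positive. [folklore] -/
theorem exitTime_brownian_pos (ha : a < 0) (hb : 0 < b) (ω : ℝ≥0 → ℝ) :
    0 < Process.exitTime Process.brownian a b ω :=
  Process.exitTime_pos (Process.continuous_brownian ω) (brownian_zero_mem_Ioo ha hb ω)

/-! ### The stopped path -/

/-- The stopped Brownian path `S_t = B_{t ∧ τ}` stays in `[a, b]` (`a < 0 < b`). [folklore] -/
theorem stoppedProcess_brownian_exitTime_mem_Icc (ha : a < 0) (hb : 0 < b) (t : ℝ≥0)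
    (ω : ℝ≥0 → ℝ) :
    stoppedProcess Process.brownian (Process.exitTime Process.brownian a b) t ω ∈ Icc a b :=
  Process.stoppedProcess_exitTime_mem_Icc (Process.continuous_brownian ω)
    (brownian_zero_mem_Ioo ha hb ω) t

/-- `|S_t| ≤ max (-a) b` for the stopped Brownian path (`a < 0 < b`). [folklore] -/
theorem abs_stoppedProcess_brownian_exitTime_le (ha : a < 0) (hb : 0 < b) (t : ℝ≥0)
    (ω : ℝ≥0 → ℝ) :
    |stoppedProcess Process.brownian (Process.exitTime Process.brownian a b) t ω| ≤ max (-a) b := by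
  have h := stoppedProcess_brownian_exitTime_mem_Icc ha hb t ω
  have h1 := le_max_left (-a) b
  have h2 := le_max_right (-a) b
  rw [abs_le]
  exact ⟨by linarith [h.1], by linarith [h.2]⟩

/-- `S_t² ≤ max (a²) (b²)` for the stopped Brownian path (`a < 0 < b`). [folklore] -/
theorem stoppedProcess_brownian_exitTime_sq_le (ha : a < 0) (hb : 0 < b) (t : ℝ≥0)
    (ω : ℝ≥0 → ℝ) :
    stoppedProcess Process.brownian (Process.exitTime Process.brownian a b) t ω ^ 2 ≤
      max (a ^ 2) (b ^ 2) := by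
  have h := stoppedProcess_brownian_exitTime_mem_Icc ha hb t ω
  set s := stoppedProcess Process.brownian (Process.exitTime Process.brownian a b) t ω
  rcases le_total 0 s with hs | hs
  · exact (pow_le_pow_left₀ hs h.2 2).trans (le_max_right _ _)
  · have : s ^ 2 ≤ a ^ 2 := by nlinarith [h.1]
    exact this.trans (le_max_left _ _)

/-- The stopped Brownian path is strongly adapted to the Brownian filtration. [folklore] -/
theorem stronglyAdapted_stoppedProcess_brownian_exitTime (a b : ℝ) :
    StronglyAdapted brownianFiltration
      (stoppedProcess Process.brownian (Process.exitTime Process.brownian a b)) :=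
  Process.stronglyAdapted_stoppedProcess_exitTime adapted_brownian Process.continuous_brownian

/-- The stopped Brownian path at time `t` is measurable. [folklore] -/
theorem measurable_stoppedProcess_brownian_exitTime (a b : ℝ) (t : ℝ≥0) :
    Measurable fun ω ↦ stoppedProcess Process.brownian (Process.exitTime Process.brownian a b) t ω :=
  (((stronglyAdapted_stoppedProcess_brownian_exitTime a b) t).mono
    (brownianFiltration.le t)).measurable

/-- The stopped clock `ω ↦ t ∧ τ(ω)` is `𝓕ᵂ_t`-measurable. [folklore] -/
theorem measurable_untopA_min_exitTime_brownian (a b : ℝ) (t : ℝ≥0) :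
    Measurable[brownianFiltration t] fun ω ↦
      (min (t : WithTop ℝ≥0) (Process.exitTime Process.brownian a b ω)).untopA := by
  have hst := (isStoppingTime_exitTime_brownian a b).min_const t
  have hmeas : Measurable[brownianFiltration t] fun ω ↦
      min (Process.exitTime Process.brownian a b ω) (t : WithTop ℝ≥0) :=
    hst.measurable_of_le fun ω ↦ min_le_right _ _
  have := hmeas.untopA
  simpa only [min_comm] using this

/-- The stopped clock `ω ↦ t ∧ τ(ω)`, read in `ℝ`, is measurable. [folklore] -/
theorem measurable_untopA_min_exitTime_brownian_real (a b : ℝ) (t : ℝ≥0) :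
    Measurable fun ω ↦ (((min (t : WithTop ℝ≥0)
      (Process.exitTime Process.brownian a b ω)).untopA : ℝ≥0) : ℝ) :=
  (((measurable_untopA_min_exitTime_brownian a b t).mono (brownianFiltration.le t)
    le_rfl)).coe_nnreal_real

/-- The stopped clock is bounded by `t`: `0 ≤ t ∧ τ ≤ t`. [folklore] -/
theorem untopA_min_exitTime_brownian_le (a b : ℝ) (t : ℝ≥0) (ω : ℝ≥0 → ℝ) :
    (((min (t : WithTop ℝ≥0) (Process.exitTime Process.brownian a b ω)).untopA : ℝ≥0) : ℝ) ≤ t := by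
  exact_mod_cast Process.untopA_min_coe_le t _

/-- Integrability of the (bounded) stopped clock. [folklore] -/
theorem integrable_untopA_min_exitTime_brownian (a b : ℝ) (t : ℝ≥0) :
    Integrable (fun ω ↦ (((min (t : WithTop ℝ≥0)
      (Process.exitTime Process.brownian a b ω)).untopA : ℝ≥0) : ℝ)) Process.preWienerMeasure := by
  haveI := isProbabilityMeasure_preWienerMeasure'
  refine (integrable_const (t : ℝ)).mono'
    (measurable_untopA_min_exitTime_brownian_real a b t).aestronglyMeasurable
    (ae_of_all _ fun ω ↦ ?_)
  rw [Real.norm_eq_abs, abs_of_nonneg (NNReal.coe_nonneg _)]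
  exact untopA_min_exitTime_brownian_le a b t ω

/-- Integrability of the square of the (bounded) stopped path (`a < 0 < b`). [folklore] -/
theorem integrable_stoppedProcess_brownian_exitTime_sq (ha : a < 0) (hb : 0 < b) (t : ℝ≥0) :
    Integrable (fun ω ↦ stoppedProcess Process.brownian (Process.exitTime Process.brownian a b)
      t ω ^ 2) Process.preWienerMeasure := by
  haveI := isProbabilityMeasure_preWienerMeasure'
  refine (integrable_const (max (a ^ 2) (b ^ 2))).mono'
    ((measurable_stoppedProcess_brownian_exitTime a b t).pow_const 2).aestronglyMeasurable
    (ae_of_all _ fun ω ↦ ?_)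
  rw [Real.norm_eq_abs, abs_of_nonneg (sq_nonneg _)]
  exact stoppedProcess_brownian_exitTime_sq_le ha hb t ω

/-- Integrability of the (bounded) stopped path (`a < 0 < b`). [folklore] -/
theorem integrable_stoppedProcess_brownian_exitTime (ha : a < 0) (hb : 0 < b) (t : ℝ≥0) :
    Integrable (fun ω ↦ stoppedProcess Process.brownian (Process.exitTime Process.brownian a b)
      t ω) Process.preWienerMeasure := by
  haveI := isProbabilityMeasure_preWienerMeasure'
  refine (integrable_const (max (-a) b)).mono'
    (measurable_stoppedProcess_brownian_exitTime a b t).aestronglyMeasurable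
    (ae_of_all _ fun ω ↦ ?_)
  rw [Real.norm_eq_abs]
  exact abs_stoppedProcess_brownian_exitTime_le ha hb t ω

/-! ### Optional stopping: `E[S_t] = 0` and `E[S_t²] = E[t ∧ τ]` -/

/-- The exit time is an optional time of the Brownian filtration. [folklore] -/
theorem isOptionalTime_exitTime_brownian (a b : ℝ) :
    IsOptionalTime brownianFiltration (Process.exitTime Process.brownian a b) :=
  (isStoppingTime_exitTime_brownian a b).isOptionalTime

/-- **The stopped Brownian path is an a.e. martingale** (optional stopping of the martingale `B`
at the optional time `τ`; raw filtration). Revuz–Yor (1999), Ch. II, §3. [folklore] -/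
theorem isAEMartingale_stoppedProcess_brownian (a b : ℝ) :
    IsAEMartingale (stoppedProcess Process.brownian (Process.exitTime Process.brownian a b))
      brownianFiltration Process.preWienerMeasure := by
  haveI := isProbabilityMeasure_preWienerMeasure'
  exact martingale_brownian_holds.isAEMartingale_stoppedProcess
    (ae_of_all _ Process.continuous_brownian) (isOptionalTime_exitTime_brownian a b)

/-- **The stopped quadratic martingale `S_t² - (t ∧ τ)` is an a.e. martingale** (optional stopping
of `B² - t` at `τ`). Revuz–Yor (1999), Ch. II, §3. [folklore] -/
theorem isAEMartingale_stoppedProcess_brownian_sq_sub (a b : ℝ) :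
    IsAEMartingale (stoppedProcess (fun t ω ↦ Process.brownian t ω ^ 2 - (t : ℝ))
      (Process.exitTime Process.brownian a b)) brownianFiltration Process.preWienerMeasure := by
  haveI := isProbabilityMeasure_preWienerMeasure'
  exact martingale_brownian_sq_sub_holds.isAEMartingale_stoppedProcess
    (ae_of_all _ fun ω ↦ ((Process.continuous_brownian ω).pow 2).sub
      NNReal.continuous_coe) (isOptionalTime_exitTime_brownian a b)

/-- Unfolding of the stopped quadratic martingale: `(B² - ·)^τ_t = S_t² - (t ∧ τ)`. [folklore] -/
theorem stoppedProcess_sq_sub_apply (a b : ℝ) (t : ℝ≥0) (ω : ℝ≥0 → ℝ) :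
    stoppedProcess (fun t ω ↦ Process.brownian t ω ^ 2 - (t : ℝ))
        (Process.exitTime Process.brownian a b) t ω =
      stoppedProcess Process.brownian (Process.exitTime Process.brownian a b) t ω ^ 2 -
        (((min (t : WithTop ℝ≥0) (Process.exitTime Process.brownian a b ω)).untopA : ℝ≥0) : ℝ) :=
  rfl

/-- The expectation of an a.e. martingale of the Brownian filtration is constant:
`E[M_t] = E[M_0]`. [folklore] -/
theorem integral_eq_integral_zero_of_isAEMartingale {M : ℝ≥0 → (ℝ≥0 → ℝ) → ℝ}
    (hM : IsAEMartingale M brownianFiltration Process.preWienerMeasure) (t : ℝ≥0) :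
    ∫ ω, M t ω ∂Process.preWienerMeasure = ∫ ω, M 0 ω ∂Process.preWienerMeasure := by
  haveI := isProbabilityMeasure_preWienerMeasure'
  have h := hM.integral_mul_eq (by simp : (0 : ℝ≥0) ≤ t) (H := fun _ ↦ (1 : ℝ))
    aestronglyMeasurable_const (C := 1) (ae_of_all _ fun _ ↦ by simp)
  simpa using h

/-- At time `0` the stopped path is `B_0 = 0`. [folklore] -/
theorem stoppedProcess_brownian_exitTime_zero (a b : ℝ) (ω : ℝ≥0 → ℝ) :
    stoppedProcess Process.brownian (Process.exitTime Process.brownian a b) 0 ω = 0 := by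
  have h0 : ((0 : ℝ≥0) : WithTop ℝ≥0) ≤ Process.exitTime Process.brownian a b ω := by
    simp
  rw [stoppedProcess_eq_of_le h0, Process.brownian_zero]
  rfl

/-- **`E[S_t] = 0`**: the stopped Brownian path has expectation zero. Durrett (2019), proof of
Thm. 7.5.3 ("`x = E_x B(T ∧ t)`"). [cite: Durrett2019, Thm. 7.5.3] -/
theorem integral_stoppedProcess_brownian_exitTime (a b : ℝ) (t : ℝ≥0) :
    ∫ ω, stoppedProcess Process.brownian (Process.exitTime Process.brownian a b) t ω
      ∂Process.preWienerMeasure = 0 := by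
  rw [integral_eq_integral_zero_of_isAEMartingale (isAEMartingale_stoppedProcess_brownian a b) t]
  simp [stoppedProcess_brownian_exitTime_zero]

/-- At time `0` the stopped clock is `0`. [folklore] -/
theorem untopA_min_zero_exitTime_brownian (a b : ℝ) (ω : ℝ≥0 → ℝ) :
    (((min ((0 : ℝ≥0) : WithTop ℝ≥0) (Process.exitTime Process.brownian a b ω)).untopA : ℝ≥0) :
      ℝ) = 0 := by
  have h0 : min ((0 : ℝ≥0) : WithTop ℝ≥0) (Process.exitTime Process.brownian a b ω) = (0 : ℝ≥0) :=
    min_eq_left (by simp)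
  rw [h0]
  rfl

/-- **`E[t ∧ τ] = E[S_t²]`** (`a < 0 < b`): optional stopping of `B² - t` at the exit time.
Durrett (2019), proof of Thm. 7.5.5 ("`E_0(B²(T ∧ t)) = E_0(T ∧ t)`").
[cite: Durrett2019, Thm. 7.5.5] -/
theorem integral_min_exitTime_brownian_eq (ha : a < 0) (hb : 0 < b) (t : ℝ≥0) :
    ∫ ω, (((min (t : WithTop ℝ≥0) (Process.exitTime Process.brownian a b ω)).untopA : ℝ≥0) : ℝ)
        ∂Process.preWienerMeasure =
      ∫ ω, stoppedProcess Process.brownian (Process.exitTime Process.brownian a b) t ω ^ 2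
        ∂Process.preWienerMeasure := by
  have h := integral_eq_integral_zero_of_isAEMartingale
    (isAEMartingale_stoppedProcess_brownian_sq_sub a b) t
  simp only [stoppedProcess_sq_sub_apply, stoppedProcess_brownian_exitTime_zero,
    untopA_min_zero_exitTime_brownian] at h
  rw [integral_sub (integrable_stoppedProcess_brownian_exitTime_sq ha hb t)
    (integrable_untopA_min_exitTime_brownian a b t)] at h
  simp only [ne_eq, OfNat.ofNat_ne_zero, not_false_eq_true, zero_pow, sub_self,
    integral_zero] at h
  linarith

/-- **`E[t ∧ τ] ≤ max (a²) (b²)`** (`a < 0 < b`). Durrett (2019), proof of Thm. 7.5.5.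
[cite: Durrett2019, Thm. 7.5.5] -/
theorem integral_min_exitTime_brownian_le (ha : a < 0) (hb : 0 < b) (t : ℝ≥0) :
    ∫ ω, (((min (t : WithTop ℝ≥0) (Process.exitTime Process.brownian a b ω)).untopA : ℝ≥0) : ℝ)
        ∂Process.preWienerMeasure ≤ max (a ^ 2) (b ^ 2) := by
  haveI := isProbabilityMeasure_preWienerMeasure'
  rw [integral_min_exitTime_brownian_eq ha hb t]
  have := integral_mono (integrable_stoppedProcess_brownian_exitTime_sq ha hb t)
    (integrable_const (max (a ^ 2) (b ^ 2))) fun ω ↦ stoppedProcess_brownian_exitTime_sq_le ha hb t ω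
  rwa [integral_const, smul_eq_mul, probReal_univ, one_mul] at this

/-! ### The exit time is a.s. finite -/

/-- **The Brownian exit time of `(a, b)` is a.s. finite** (`a < 0 < b`):
`n · P[τ = ⊤] ≤ E[n ∧ τ] ≤ max (a²) (b²)` for every `n`. Durrett (2019), Thm. 7.5.3 ("`T < ∞`
a.s."). [cite: Durrett2019, Thm. 7.5.3] -/
theorem measure_exitTime_brownian_eq_top (ha : a < 0) (hb : 0 < b) :
    Process.preWienerMeasure {ω | Process.exitTime Process.brownian a b ω = ⊤} = 0 := by
  haveI := isProbabilityMeasure_preWienerMeasure'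
  set N := {ω : ℝ≥0 → ℝ | Process.exitTime Process.brownian a b ω = ⊤} with hNdef
  have hN : MeasurableSet N := measurableSet_exitTime_brownian_eq_top a b
  have hbound : ∀ n : ℕ, (n : ℝ) * Process.preWienerMeasure.real N ≤ max (a ^ 2) (b ^ 2) := by
    intro n
    refine le_trans ?_ (integral_min_exitTime_brownian_le ha hb (n : ℝ≥0))
    have hind : ∫ ω, N.indicator (fun _ ↦ (n : ℝ)) ω ∂Process.preWienerMeasure =
        (n : ℝ) * Process.preWienerMeasure.real N := by
      rw [integral_indicator_const _ hN, smul_eq_mul, mul_comm]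
    rw [← hind]
    refine integral_mono ((integrable_const (n : ℝ)).indicator hN)
      (integrable_untopA_min_exitTime_brownian a b _) fun ω ↦ ?_
    by_cases hω : ω ∈ N
    · rw [indicator_of_mem hω]
      have hω' : Process.exitTime Process.brownian a b ω = ⊤ := hω
      rw [hω', min_top_right]
      push_cast
      exact le_rfl
    · rw [indicator_of_notMem hω]; exact NNReal.coe_nonneg _
  by_contra hne
  have hpos : 0 < Process.preWienerMeasure.real N :=
    lt_of_le_of_ne measureReal_nonneg
      (Ne.symm fun h ↦ hne ((measureReal_eq_zero_iff (measure_ne_top _ _)).1 h))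
  obtain ⟨n, hn⟩ := exists_nat_gt (max (a ^ 2) (b ^ 2) / Process.preWienerMeasure.real N)
  have h1 := hbound n
  rw [div_lt_iff₀ hpos] at hn
  linarith

/-- **The Brownian exit time of `(a, b)` is a.s. finite** (`a < 0 < b`), almost-everywhere form.
Durrett (2019), Thm. 7.5.3. [cite: Durrett2019, Thm. 7.5.3] -/
theorem ae_exitTime_brownian_ne_top (ha : a < 0) (hb : 0 < b) :
    ∀ᵐ ω ∂Process.preWienerMeasure, Process.exitTime Process.brownian a b ω ≠ ⊤ := by
  rw [ae_iff]
  simpa only [not_not] using measure_exitTime_brownian_eq_top ha hb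

/-! ### The exit value and the exit events -/

/-- The **exit value** `B_τ` of the canonical Brownian motion from `(a, b)` (Mathlib's
`stoppedValue`; **junk**: on the event `τ = ⊤`, which is null for `a < 0 < b`, the value of
the path at an arbitrary time). Durrett (2019), Thm. 7.5.3 (`B_T`). [folklore] -/
def brownianExitValue (a b : ℝ) : (ℝ≥0 → ℝ) → ℝ :=
  stoppedValue Process.brownian (Process.exitTime Process.brownian a b)

/-- At a finite exit time `T`, the exit value is `B_T`. [folklore] -/
theorem brownianExitValue_of_eq_coe {ω : ℝ≥0 → ℝ} {T : ℝ≥0}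
    (hT : Process.exitTime Process.brownian a b ω = T) :
    brownianExitValue a b ω = Process.brownian T ω := by
  simp only [brownianExitValue, stoppedValue, hT]
  rfl

/-- **The exit value is an endpoint**: `B_τ = a` or `B_τ = b` whenever `τ < ⊤` (`a < 0 < b`).
[folklore] -/
theorem brownianExitValue_eq_or_eq (ha : a < 0) (hb : 0 < b) {ω : ℝ≥0 → ℝ}
    (hω : Process.exitTime Process.brownian a b ω ≠ ⊤) :
    brownianExitValue a b ω = a ∨ brownianExitValue a b ω = b := by
  obtain ⟨T, hT⟩ := WithTop.ne_top_iff_exists.1 hω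
  rw [brownianExitValue_of_eq_coe hT.symm]
  exact Process.apply_eq_or_eq_of_exitTime_eq_coe (Process.continuous_brownian ω)
    (brownian_zero_mem_Ioo ha hb ω) hT.symm

/-- The exit value is measurable (Mathlib `measurable_stoppedValue` for the progressively
measurable continuous process `B`). [folklore] -/
theorem measurable_brownianExitValue (a b : ℝ) : Measurable (brownianExitValue a b) :=
  (measurable_stoppedValue
    (StronglyAdapted.isStronglyProgressive_of_continuous stronglyAdapted_brownian
      Process.continuous_brownian) (isStoppingTime_exitTime_brownian a b)).mono
    ((isStoppingTime_exitTime_brownian a b).measurableSpace_le) le_rfl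

/-- From a finite exit time `T` on, the stopped path sits at the exit value. [folklore] -/
theorem stoppedProcess_eq_brownianExitValue {ω : ℝ≥0 → ℝ} {T t : ℝ≥0}
    (hT : Process.exitTime Process.brownian a b ω = T) (hTt : T ≤ t) :
    stoppedProcess Process.brownian (Process.exitTime Process.brownian a b) t ω =
      brownianExitValue a b ω := by
  rw [Process.stoppedProcess_exitTime_eq_of_ge hT hTt, brownianExitValue_of_eq_coe hT]

/-- Along integer times the stopped path is eventually equal to the exit value (`τ < ⊤`).
[folklore] -/
theorem eventually_stoppedProcess_eq_brownianExitValue {ω : ℝ≥0 → ℝ}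
    (hω : Process.exitTime Process.brownian a b ω ≠ ⊤) :
    ∀ᶠ n : ℕ in atTop, stoppedProcess Process.brownian (Process.exitTime Process.brownian a b)
      (n : ℝ≥0) ω = brownianExitValue a b ω := by
  obtain ⟨T, hT⟩ := WithTop.ne_top_iff_exists.1 hω
  obtain ⟨N, hN⟩ := exists_nat_ge (T : ℝ)
  filter_upwards [eventually_ge_atTop N] with n hn
  refine stoppedProcess_eq_brownianExitValue hT.symm ?_
  have : (T : ℝ) ≤ n := hN.trans (by exact_mod_cast hn)
  exact_mod_cast this

/-- A.s. convergence of the stopped path to the exit value along integer times (`a < 0 < b`).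
[folklore] -/
theorem ae_tendsto_stoppedProcess_brownianExitValue (ha : a < 0) (hb : 0 < b) :
    ∀ᵐ ω ∂Process.preWienerMeasure, Tendsto (fun n : ℕ ↦ stoppedProcess Process.brownian
      (Process.exitTime Process.brownian a b) (n : ℝ≥0) ω) atTop (𝓝 (brownianExitValue a b ω)) := by
  filter_upwards [ae_exitTime_brownian_ne_top ha hb] with ω hω
  exact tendsto_const_nhds.congr' (EventuallyEq.symm
    (eventually_stoppedProcess_eq_brownianExitValue hω))

/-- **`E[B_τ] = 0`** (`a < 0 < b`): bounded convergence in `E[S_n] = 0`. Durrett (2019), proof of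
Thm. 7.5.3. [cite: Durrett2019, Thm. 7.5.3] -/
theorem integral_brownianExitValue (ha : a < 0) (hb : 0 < b) :
    ∫ ω, brownianExitValue a b ω ∂Process.preWienerMeasure = 0 := by
  haveI := isProbabilityMeasure_preWienerMeasure'
  have hlim : Tendsto (fun n : ℕ ↦ ∫ ω, stoppedProcess Process.brownian
      (Process.exitTime Process.brownian a b) (n : ℝ≥0) ω ∂Process.preWienerMeasure) atTop
      (𝓝 (∫ ω, brownianExitValue a b ω ∂Process.preWienerMeasure)) :=
    tendsto_integral_of_dominated_convergence (fun _ ↦ max (-a) b)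
      (fun n ↦ (measurable_stoppedProcess_brownian_exitTime a b _).aestronglyMeasurable)
      (integrable_const _)
      (fun n ↦ ae_of_all _ fun ω ↦ by
        rw [Real.norm_eq_abs]; exact abs_stoppedProcess_brownian_exitTime_le ha hb _ ω)
      (ae_tendsto_stoppedProcess_brownianExitValue ha hb)
  simp_rw [integral_stoppedProcess_brownian_exitTime] at hlim
  exact (tendsto_nhds_unique hlim tendsto_const_nhds).symm ▸ rfl

/-- **`E[B_τ²] = lim E[S_n²] = lim E[n ∧ τ]`** (`a < 0 < b`): bounded convergence.
Durrett (2019), proof of Thm. 7.5.5. [cite: Durrett2019, Thm. 7.5.5] -/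
theorem tendsto_integral_min_exitTime_brownian (ha : a < 0) (hb : 0 < b) :
    Tendsto (fun n : ℕ ↦ ∫ ω, (((min ((n : ℝ≥0) : WithTop ℝ≥0)
      (Process.exitTime Process.brownian a b ω)).untopA : ℝ≥0) : ℝ) ∂Process.preWienerMeasure)
      atTop (𝓝 (∫ ω, brownianExitValue a b ω ^ 2 ∂Process.preWienerMeasure)) := by
  haveI := isProbabilityMeasure_preWienerMeasure'
  have hlim : Tendsto (fun n : ℕ ↦ ∫ ω, stoppedProcess Process.brownian
      (Process.exitTime Process.brownian a b) (n : ℝ≥0) ω ^ 2 ∂Process.preWienerMeasure) atTop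
      (𝓝 (∫ ω, brownianExitValue a b ω ^ 2 ∂Process.preWienerMeasure)) :=
    tendsto_integral_of_dominated_convergence (fun _ ↦ max (a ^ 2) (b ^ 2))
      (fun n ↦ ((measurable_stoppedProcess_brownian_exitTime a b _).pow_const 2).aestronglyMeasurable)
      (integrable_const _)
      (fun n ↦ ae_of_all _ fun ω ↦ by
        rw [Real.norm_eq_abs, abs_of_nonneg (sq_nonneg _)]
        exact stoppedProcess_brownian_exitTime_sq_le ha hb _ ω)
      ((ae_tendsto_stoppedProcess_brownianExitValue ha hb).mono fun ω hω ↦ hω.pow 2)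
  refine hlim.congr fun n ↦ ?_
  rw [integral_min_exitTime_brownian_eq ha hb]

/-- The **left exit event** `{τ < ⊤, B_τ = a}` of the canonical Brownian motion from `(a, b)`.
Durrett (2019), Thm. 7.5.3 (`{T_a < T_b}`). [folklore] -/
def brownianExitLeft (a b : ℝ) : Set (ℝ≥0 → ℝ) :=
  {ω | Process.exitTime Process.brownian a b ω ≠ ⊤ ∧ brownianExitValue a b ω = a}

/-- The **right exit event** `{τ < ⊤, B_τ = b}` of the canonical Brownian motion from `(a, b)`.
Durrett (2019), Thm. 7.5.3 (`{T_b < T_a}`). [folklore] -/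
def brownianExitRight (a b : ℝ) : Set (ℝ≥0 → ℝ) :=
  {ω | Process.exitTime Process.brownian a b ω ≠ ⊤ ∧ brownianExitValue a b ω = b}

/-- The left exit event is measurable. [folklore] -/
theorem measurableSet_brownianExitLeft (a b : ℝ) : MeasurableSet (brownianExitLeft a b) :=
  (measurableSet_exitTime_brownian_eq_top a b).compl.inter
    (measurable_brownianExitValue a b (measurableSet_singleton a))

/-- The right exit event is measurable. [folklore] -/
theorem measurableSet_brownianExitRight (a b : ℝ) : MeasurableSet (brownianExitRight a b) :=
  (measurableSet_exitTime_brownian_eq_top a b).compl.inter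
    (measurable_brownianExitValue a b (measurableSet_singleton b))

/-- The two exit events are disjoint (`a < b`). [folklore] -/
theorem disjoint_brownianExitLeft_brownianExitRight (hab : a < b) :
    Disjoint (brownianExitLeft a b) (brownianExitRight a b) := by
  rw [Set.disjoint_left]
  rintro ω ⟨-, ha'⟩ ⟨-, hb'⟩
  rw [ha'] at hb'
  exact hab.ne hb'

/-- Off the null event `τ = ⊤`, every path is in one of the two exit events (`a < 0 < b`).
[folklore] -/
theorem mem_brownianExitLeft_or_brownianExitRight (ha : a < 0) (hb : 0 < b) {ω : ℝ≥0 → ℝ}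
    (hω : Process.exitTime Process.brownian a b ω ≠ ⊤) :
    ω ∈ brownianExitLeft a b ∨ ω ∈ brownianExitRight a b := by
  rcases brownianExitValue_eq_or_eq ha hb hω with h | h
  · exact Or.inl ⟨hω, h⟩
  · exact Or.inr ⟨hω, h⟩

/-- A.s., `B_τ = a · 𝟙_{exit left} + b · 𝟙_{exit right}` (`a < 0 < b`). [folklore] -/
theorem brownianExitValue_ae_eq_indicator (ha : a < 0) (hb : 0 < b) :
    (brownianExitValue a b) =ᵐ[Process.preWienerMeasure]
      fun ω ↦ (brownianExitLeft a b).indicator (fun _ ↦ a) ω +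
        (brownianExitRight a b).indicator (fun _ ↦ b) ω := by
  filter_upwards [ae_exitTime_brownian_ne_top ha hb] with ω hω
  have hdisj := disjoint_brownianExitLeft_brownianExitRight (ha.trans hb)
  rcases mem_brownianExitLeft_or_brownianExitRight ha hb hω with h | h
  · rw [indicator_of_mem h, indicator_of_notMem (Set.disjoint_left.1 hdisj h), add_zero]
    exact h.2
  · rw [indicator_of_notMem (Set.disjoint_right.1 hdisj h), indicator_of_mem h, zero_add]
    exact h.2

/-- A.s., `B_τ² = a² · 𝟙_{exit left} + b² · 𝟙_{exit right}` (`a < 0 < b`). [folklore] -/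
theorem brownianExitValue_sq_ae_eq_indicator (ha : a < 0) (hb : 0 < b) :
    (fun ω ↦ brownianExitValue a b ω ^ 2) =ᵐ[Process.preWienerMeasure]
      fun ω ↦ (brownianExitLeft a b).indicator (fun _ ↦ a ^ 2) ω +
        (brownianExitRight a b).indicator (fun _ ↦ b ^ 2) ω := by
  filter_upwards [ae_exitTime_brownian_ne_top ha hb] with ω hω
  have hdisj := disjoint_brownianExitLeft_brownianExitRight (ha.trans hb)
  rcases mem_brownianExitLeft_or_brownianExitRight ha hb hω with h | h
  · rw [indicator_of_mem h, indicator_of_notMem (Set.disjoint_left.1 hdisj h), add_zero, h.2]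
  · rw [indicator_of_notMem (Set.disjoint_right.1 hdisj h), indicator_of_mem h, zero_add, h.2]

/-- **The exit probabilities sum to one** (`a < 0 < b`): `P[exit left] + P[exit right] = 1`.
Durrett (2019), Thm. 7.5.3. [cite: Durrett2019, Thm. 7.5.3] -/
theorem measureReal_brownianExitLeft_add (ha : a < 0) (hb : 0 < b) :
    Process.preWienerMeasure.real (brownianExitLeft a b) +
      Process.preWienerMeasure.real (brownianExitRight a b) = 1 := by
  haveI := isProbabilityMeasure_preWienerMeasure'
  rw [← measureReal_union (disjoint_brownianExitLeft_brownianExitRight (ha.trans hb))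
    (measurableSet_brownianExitRight a b)]
  have : Process.preWienerMeasure.real (brownianExitLeft a b ∪ brownianExitRight a b) =
      Process.preWienerMeasure.real univ := by
    refine measureReal_congr ?_
    refine (ae_eq_univ).2 ?_
    rw [← nonpos_iff_eq_zero, ← measure_exitTime_brownian_eq_top ha hb]
    refine measure_mono fun ω hω ↦ ?_
    by_contra hω'
    exact hω (mem_brownianExitLeft_or_brownianExitRight ha hb hω')
  rw [this, probReal_univ]

/-- **`a · P[exit left] + b · P[exit right] = 0`** (`a < 0 < b`): the identity `E[B_τ] = 0`
read on the two exit events. Durrett (2019), proof of Thm. 7.5.3.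
[cite: Durrett2019, Thm. 7.5.3] -/
theorem mul_measureReal_brownianExitLeft_add (ha : a < 0) (hb : 0 < b) :
    a * Process.preWienerMeasure.real (brownianExitLeft a b) +
      b * Process.preWienerMeasure.real (brownianExitRight a b) = 0 := by
  haveI := isProbabilityMeasure_preWienerMeasure'
  have h := integral_brownianExitValue ha hb
  rw [integral_congr_ae (brownianExitValue_ae_eq_indicator ha hb),
    integral_add ((integrable_const a).indicator (measurableSet_brownianExitLeft a b))
      ((integrable_const b).indicator (measurableSet_brownianExitRight a b)),
    integral_indicator_const _ (measurableSet_brownianExitLeft a b),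
    integral_indicator_const _ (measurableSet_brownianExitRight a b)] at h
  simpa [smul_eq_mul, mul_comm] using h

/-- **Gambler's ruin for Brownian motion, right exit** (`a < 0 < b`):
`P[B exits (a, b) at b] = -a / (b - a)`. Durrett (2019), Thm. 7.5.3 (`x = 0`:
`P_0(T_b < T_a) = (0 - a)/(b - a)`). [cite: Durrett2019, Thm. 7.5.3] -/
theorem measureReal_brownianExitRight (ha : a < 0) (hb : 0 < b) :
    Process.preWienerMeasure.real (brownianExitRight a b) = -a / (b - a) := by
  have h1 := measureReal_brownianExitLeft_add ha hb
  have h2 := mul_measureReal_brownianExitLeft_add ha hb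
  have hab : 0 < b - a := by linarith
  rw [eq_div_iff hab.ne']
  nlinarith [h1, h2]

/-- **Gambler's ruin for Brownian motion, left exit** (`a < 0 < b`):
`P[B exits (a, b) at a] = b / (b - a)`. Durrett (2019), Thm. 7.5.3 (`x = 0`:
`P_0(T_a < T_b) = (b - 0)/(b - a)`). [cite: Durrett2019, Thm. 7.5.3] -/
theorem measureReal_brownianExitLeft (ha : a < 0) (hb : 0 < b) :
    Process.preWienerMeasure.real (brownianExitLeft a b) = b / (b - a) := by
  have h1 := measureReal_brownianExitLeft_add ha hb
  have h2 := measureReal_brownianExitRight ha hb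
  have hab : 0 < b - a := by linarith
  rw [h2] at h1
  field_simp at h1
  rw [eq_div_iff hab.ne']
  linarith

/-- **`E[B_τ²] = -ab`** (`a < 0 < b`). Durrett (2019), proof of Thm. 7.5.5
("`E_0 B_T² = a² b/(b-a) + b² (-a)/(b-a) = -ab`"). [cite: Durrett2019, Thm. 7.5.5] -/
theorem integral_brownianExitValue_sq (ha : a < 0) (hb : 0 < b) :
    ∫ ω, brownianExitValue a b ω ^ 2 ∂Process.preWienerMeasure = -(a * b) := by
  haveI := isProbabilityMeasure_preWienerMeasure'
  rw [integral_congr_ae (brownianExitValue_sq_ae_eq_indicator ha hb),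
    integral_add ((integrable_const (a ^ 2)).indicator (measurableSet_brownianExitLeft a b))
      ((integrable_const (b ^ 2)).indicator (measurableSet_brownianExitRight a b)),
    integral_indicator_const _ (measurableSet_brownianExitLeft a b),
    integral_indicator_const _ (measurableSet_brownianExitRight a b),
    measureReal_brownianExitLeft ha hb, measureReal_brownianExitRight ha hb]
  have hab : (b - a) ≠ 0 := by linarith
  simp only [smul_eq_mul]
  field_simp
  ring

/-! ### The expected exit time: `E[τ] = -ab` -/

/-- The **real-valued exit time** of `(a, b)` by the canonical Brownian motion (junk `0` on the
event `τ = ⊤`, null for `a < 0 < b`). Durrett (2019), Thm. 7.5.5 (`T`). [folklore] -/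
def brownianExitTimeReal (a b : ℝ) (ω : ℝ≥0 → ℝ) : ℝ :=
  ((Process.exitTime Process.brownian a b ω).untopD 0 : ℝ≥0)

/-- The real-valued exit time is nonnegative. [folklore] -/
theorem brownianExitTimeReal_nonneg (a b : ℝ) (ω : ℝ≥0 → ℝ) : 0 ≤ brownianExitTimeReal a b ω :=
  NNReal.coe_nonneg _

/-- At a finite exit time `T`, the real-valued exit time is `T`. [folklore] -/
theorem brownianExitTimeReal_of_eq_coe {ω : ℝ≥0 → ℝ} {T : ℝ≥0}
    (hT : Process.exitTime Process.brownian a b ω = T) : brownianExitTimeReal a b ω = T := by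
  simp only [brownianExitTimeReal, hT]
  rfl

/-- The real-valued exit time is measurable. [folklore] -/
theorem measurable_brownianExitTimeReal (a b : ℝ) : Measurable (brownianExitTimeReal a b) :=
  ((measurable_exitTime_brownian a b).untopD _).coe_nnreal_real

/-- The stopped clocks are bounded by the exit time: `t ∧ τ ≤ τ` (read in `ℝ`, off `τ = ⊤`).
[folklore] -/
theorem untopA_min_le_brownianExitTimeReal {ω : ℝ≥0 → ℝ}
    (hω : Process.exitTime Process.brownian a b ω ≠ ⊤) (t : ℝ≥0) :
    (((min (t : WithTop ℝ≥0) (Process.exitTime Process.brownian a b ω)).untopA : ℝ≥0) : ℝ) ≤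
      brownianExitTimeReal a b ω := by
  obtain ⟨T, hT⟩ := WithTop.ne_top_iff_exists.1 hω
  rw [brownianExitTimeReal_of_eq_coe hT.symm, ← hT]
  rcases le_total t T with h | h
  · rw [min_eq_left (WithTop.coe_le_coe.2 h)]
    exact_mod_cast h
  · rw [min_eq_right (WithTop.coe_le_coe.2 h)]
    exact le_rfl

/-- The stopped clocks `n ∧ τ` increase in `n`. [folklore] -/
theorem monotone_untopA_min_exitTime_brownian (ω : ℝ≥0 → ℝ) :
    Monotone fun n : ℕ ↦ (((min ((n : ℝ≥0) : WithTop ℝ≥0)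
      (Process.exitTime Process.brownian a b ω)).untopA : ℝ≥0) : ℝ) := by
  intro m n hmn
  dsimp only
  rcases eq_or_ne (Process.exitTime Process.brownian a b ω) ⊤ with htop | hne
  · rw [htop, min_top_right, min_top_right]
    change ((m : ℝ≥0) : ℝ) ≤ ((n : ℝ≥0) : ℝ)
    exact_mod_cast hmn
  · obtain ⟨T, hT⟩ := WithTop.ne_top_iff_exists.1 hne
    rw [← hT]
    have key : ∀ k : ℕ, (((min ((k : ℝ≥0) : WithTop ℝ≥0) (T : WithTop ℝ≥0)).untopA : ℝ≥0) : ℝ)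
        = ((min (k : ℝ≥0) T : ℝ≥0) : ℝ) := fun k ↦ by
      rw [← WithTop.coe_min]; rfl
    rw [key m, key n]
    exact_mod_cast min_le_min_right T (Nat.cast_le.2 hmn)

/-- Along integer times the stopped clocks are eventually equal to the exit time (`τ < ⊤`).
[folklore] -/
theorem eventually_untopA_min_eq_brownianExitTimeReal {ω : ℝ≥0 → ℝ}
    (hω : Process.exitTime Process.brownian a b ω ≠ ⊤) :
    ∀ᶠ n : ℕ in atTop, (((min ((n : ℝ≥0) : WithTop ℝ≥0)
      (Process.exitTime Process.brownian a b ω)).untopA : ℝ≥0) : ℝ) = brownianExitTimeReal a b ω := by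
  obtain ⟨T, hT⟩ := WithTop.ne_top_iff_exists.1 hω
  obtain ⟨N, hN⟩ := exists_nat_ge (T : ℝ)
  filter_upwards [eventually_ge_atTop N] with n hn
  have hTn : T ≤ (n : ℝ≥0) := by
    have : (T : ℝ) ≤ n := hN.trans (by exact_mod_cast hn)
    exact_mod_cast this
  rw [brownianExitTimeReal_of_eq_coe hT.symm, ← hT, min_eq_right (WithTop.coe_le_coe.2 hTn)]
  rfl

/-- **`E[τ] = -ab`** for the exit time of `(a, b)` by Brownian motion started at `0`
(`a < 0 < b`); in particular the real-valued exit time is integrable. Monotone convergence in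
`E[n ∧ τ] = E[S_n²] → E[B_τ²] = -ab`. Durrett (2019), Thm. 7.5.5. [cite: Durrett2019, Thm. 7.5.5] -/
theorem integrable_brownianExitTimeReal (ha : a < 0) (hb : 0 < b) :
    Integrable (brownianExitTimeReal a b) Process.preWienerMeasure := by
  haveI := isProbabilityMeasure_preWienerMeasure'
  -- monotone convergence for the lower integrals of the stopped clocks
  set f : ℕ → (ℝ≥0 → ℝ) → ℝ := fun n ω ↦ (((min ((n : ℝ≥0) : WithTop ℝ≥0)
    (Process.exitTime Process.brownian a b ω)).untopA : ℝ≥0) : ℝ) with hf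
  have hfm : ∀ n, Measurable (f n) := fun n ↦ measurable_untopA_min_exitTime_brownian_real a b _
  have hmono : ∀ ω, Monotone fun n ↦ f n ω := fun ω ↦ monotone_untopA_min_exitTime_brownian ω
  have hlim : ∀ᵐ ω ∂Process.preWienerMeasure,
      Tendsto (fun n ↦ f n ω) atTop (𝓝 (brownianExitTimeReal a b ω)) := by
    filter_upwards [ae_exitTime_brownian_ne_top ha hb] with ω hω
    exact tendsto_const_nhds.congr' (EventuallyEq.symm
      (eventually_untopA_min_eq_brownianExitTimeReal hω))
  have hlint : ∫⁻ ω, ENNReal.ofReal (brownianExitTimeReal a b ω) ∂Process.preWienerMeasure ≤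
      ENNReal.ofReal (max (a ^ 2) (b ^ 2)) := by
    have key : ∀ᵐ ω ∂Process.preWienerMeasure, ENNReal.ofReal (brownianExitTimeReal a b ω) =
        ⨆ n, ENNReal.ofReal (f n ω) := by
      filter_upwards [hlim] with ω hω
      have hmono' : Monotone fun n ↦ ENNReal.ofReal (f n ω) :=
        fun m n hmn ↦ ENNReal.ofReal_le_ofReal (hmono ω hmn)
      exact tendsto_nhds_unique ((ENNReal.continuous_ofReal.tendsto _).comp hω)
        (tendsto_atTop_iSup hmono')
    rw [lintegral_congr_ae key, lintegral_iSup (fun n ↦ (hfm n).ennreal_ofReal)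
      (fun m n hmn ω ↦ ENNReal.ofReal_le_ofReal (hmono ω hmn))]
    refine iSup_le fun n ↦ ?_
    rw [← ofReal_integral_eq_lintegral_ofReal (integrable_untopA_min_exitTime_brownian a b _)
      (ae_of_all _ fun ω ↦ NNReal.coe_nonneg _)]
    exact ENNReal.ofReal_le_ofReal (integral_min_exitTime_brownian_le ha hb _)
  refine ⟨(measurable_brownianExitTimeReal a b).aestronglyMeasurable, ?_⟩
  rw [hasFiniteIntegral_iff_ofReal (ae_of_all _ fun ω ↦ brownianExitTimeReal_nonneg a b ω)]
  exact hlint.trans_lt ENNReal.ofReal_lt_top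

/-- **`E[τ] = -ab`** for the exit time of `(a, b)` by Brownian motion started at `0`
(`a < 0 < b`). Durrett (2019), Thm. 7.5.5 ("Let `T = inf{t : B_t ∉ (a, b)}`, where `a < 0 < b`.
`E_0 T = -ab`"). [cite: Durrett2019, Thm. 7.5.5] -/
theorem integral_brownianExitTimeReal (ha : a < 0) (hb : 0 < b) :
    ∫ ω, brownianExitTimeReal a b ω ∂Process.preWienerMeasure = -(a * b) := by
  haveI := isProbabilityMeasure_preWienerMeasure'
  set f : ℕ → (ℝ≥0 → ℝ) → ℝ := fun n ω ↦ (((min ((n : ℝ≥0) : WithTop ℝ≥0)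
    (Process.exitTime Process.brownian a b ω)).untopA : ℝ≥0) : ℝ) with hf
  have hlim : ∀ᵐ ω ∂Process.preWienerMeasure,
      Tendsto (fun n ↦ f n ω) atTop (𝓝 (brownianExitTimeReal a b ω)) := by
    filter_upwards [ae_exitTime_brownian_ne_top ha hb] with ω hω
    exact tendsto_const_nhds.congr' (EventuallyEq.symm
      (eventually_untopA_min_eq_brownianExitTimeReal hω))
  have h1 : Tendsto (fun n ↦ ∫ ω, f n ω ∂Process.preWienerMeasure) atTop
      (𝓝 (∫ ω, brownianExitTimeReal a b ω ∂Process.preWienerMeasure)) :=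
    integral_tendsto_of_tendsto_of_monotone
      (fun n ↦ integrable_untopA_min_exitTime_brownian a b _)
      (integrable_brownianExitTimeReal ha hb)
      (ae_of_all _ fun ω ↦ monotone_untopA_min_exitTime_brownian ω) hlim
  have h2 := tendsto_integral_min_exitTime_brownian ha hb
  rw [integral_brownianExitValue_sq ha hb] at h2
  exact tendsto_nhds_unique h1 h2

end Literature.Probability.RandomPlanarGeometry
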